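import Literature.Computability.Cryptography.RegevReductionCVPqSamplerSplit
import Literature.Computability.Cryptography.RegevReductionLemma32Sampler
import Literature.Computability.Cryptography.FloorGaussianSampling
import HarnessLib

/-!
# Regev 2009, Lemma 3.11 — the rounded-Gaussian coin sampler of the reduction: A_gsamp PROVED

Topic `Computability/Cryptography` (family `pqc`), sequel of `RegevReductionCVPqSamplerSplit.lean`, which
split the classical half of Regev's quantum step (residual A_cvpqM) into NUMERICS — the named fact
`floorGaussianSamplerFP` (**A_gsamp**): a polynomial-time string function turning fair coins into an
integer `⌊M·e⌋`, `e ← N(0, s/2π)`, within statistical distance `2^{-ℓ}`, uniformly in the parameters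
`⟨M, ⟨s, 1^ℓ⟩⟩` — and PLUMBING (A_plumb), and proved `A_gsamp → A_plumb → A_cvpqM`. O. Regev, *On
lattices, learning with errors, random linear codes, and cryptography*, J. ACM 56 (2009), art. 34
(author's version arXiv:2401.03703): Lemma 3.11 (p. 18, proof: "samples from `Ψ_β` can be drawn
efficiently"), with the integer-Gaussian rejection sampler of Gentry–Peikert–Vaikuntanathan 2008, §4.1
as made exact-rational in the tree (`GaussRejMachine.rejOf`, accuracy uniform in the width
`BLPRS2013.tvDist_rejLaw_wide_le`, Brakerski et al. 2013, §5) and the comparison of the integer and the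
rounded continuous Gaussian (`Regev2009.tvDist_discreteGaussianInt_floorGaussian_le`, Peikert 2010, §3.3).

THIS FILE PROVES A_gsamp (`Regev2009.floorGaussianSamplerFP_holds : floorGaussianSamplerFP`), so that
A_cvpqM becomes a theorem of A_plumb alone and the trust base of `pqc.S19` shrinks from
{A_gsamp, A_plumb, A_q14} to {A_plumb, A_q14}.

## The sampler

On `(M, s, ℓ)` with `M ≥ 1`, `s > 0` (otherwise the target `floorGaussian M σ`, `σ² = s`, is the point
mass at `0` and the program prints `0`): precision `n = 2ℓ + 20`; fine grid `M′ = 4ⁿ·den(s)`, so that the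
fine width `S′ = M′M√s = √R₂`, `R₂ = (M′M)²s ∈ ℚ`, is at least `4ⁿ`; a RATIONAL upper bracket
`ρ = (⌊√round(4ⁿR₂)⌋ + 1)/2ⁿ ∈ [S′, S′ + 2/2ⁿ]` (integer square root); the tree's width parameter
`A = bootA ρ n` (Machin `π`), whose sampler width `S̃ = A√(π/n)` satisfies `ρ ≤ S̃ ≤ ρ(1 + 2/2ⁿ)`
(`rho_le_bootWidth`, `bootWidth_le`); ONE run of the rejection sampler `rejOf (bootCtx ρ n)` for
`D_{ℤ,S̃}` on the coins; output `⌊z/M′⌋`. Error budget (`tvDist_map_rejLaw_floorGaussian_le`):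
sampler `113(⌊√n⌋+1)/2ⁿ`; `Δ(D_{ℤ,S̃}, ⌊S̃·G⌋) ≤ 2/S̃ ≤ 1/2ⁿ`; `⌊⌊M′M σ′G⌋/M′⌋ = ⌊Mσ′G⌋` exactly
(`floorGaussian_map_ediv`); width perturbation `Δ(⌊Mσ′G⌋, ⌊MσG⌋) ≤ 1 − σ/σ′ = 1 − S′/S̃ ≤ 5/2ⁿ` by
cell-wise domination of the densities (`tvDist_floorGaussian_width_le`); total `≤ 114n/2ⁿ ≤ 2^{-ℓ}`.
Polynomial time is composition of the tree's `CodeFP` bricks (`gsOut_codeFP`); the coins read are at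
most `6912·|⟨M, ⟨s, 1^ℓ⟩⟩|³` (`gsCoins_le`).

## What this file does

* Statistics of `floorGaussian`: `floorGaussian_congr` (depends on `(Lα₀)²` only),
  `floorGaussian_of_mul_eq_zero`, `floorGaussian_map_ediv` (grid refinement), `mul_floorGaussian_le`,
  `tvDist_floorGaussian_width_le`.
* Parameters `gsPrec`, `gsFine`, `gsWidthSq`, `gsN`, `gsRho`, `gsCoins` with `pow_le_gsWidthSq`,
  `sqrt_gsWidthSq`, `sqrt_le_gsRho` (the bracket), `gsN_le`, `natAbs_num_gsRho_le`, `gsCoins_le`.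
* The program `gsOut` on `GSIn = (ℕ × ℚ × ℕ) × List Bool` and its polynomial-time computation from the
  code `gsInE = boolPair (sampParams M s ℓ) coins` in sign-magnitude output (`gsOut_codeFP`, via the
  input-generic `bootA_codeFP_of`, `bootW_codeFP_of`, `rejR_codeFP_of`, `bootCtx_codeFP_of`,
  `gsRho_codeFP`).
* The law: `uniform_map_gsOut_eq` (image of `GaussRej.rejLaw` under `z ↦ z / M′`),
  `tvDist_map_rejLaw_floorGaussian_le` (the core estimate `114n/2ⁿ`), `tvDist_gsOut_le` (`≤ 2^{-ℓ}`).
* PROVED: **`Regev2009.floorGaussianSamplerFP_holds : floorGaussianSamplerFP`** (A_gsamp discharged), and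
  the corollaries `regev2009_lemma_3_11_cvpqMachine_of_plumbing : A_plumb → A_cvpqM`,
  `regev_lwe_to_sivp_quantum_holds_of_plumbing_of_step`,
  `regev_lwe_to_gapSVP_quantum_holds_of_plumbing_of_step` (`pqc.S19` from {A_plumb, A_q14}).

No new named fact is introduced. HONEST FRAMING: the value is a THEOREM — a kernel-checked, standard-axiom
proof that the coin sampler Regev's reduction needs exists in FP with the stated accuracy, discharging one
precisely typed residual of a KNOWN reduction. It is NOT progress on any summit and breaks nothing; the
remaining residuals A_plumb (TM/quantum-family plumbing) and A_q14 (the quantum step) are untouched.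

References: Regev2009 / RegevLWE2009 (arXiv:2401.03703: Lemma 3.11 p. 18); GentryPeikertVaikuntanathan2008
(§4.1: rejection sampling for `D_{ℤ,s}`); BrakerskiEtAl2013 (§5: the sampler's parameters and accuracy);
Peikert2010 (§3.3: integer vs rounded continuous Gaussian); MicciancioRegev2007 (§2: `ρ_s`);
BorweinBorwein1987 (§11.1: Machin `π`); Cohen1993 (§1.7: integer square roots); Goldreich2001 (§3.2:
statistical distance).
-/

noncomputable section

open MeasureTheory ProbabilityTheory Set Filter
open scoped Real ENNReal NNReal

namespace Literature.Computability.Cryptography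

namespace Regev2009

open Literature.Algebra.EuclideanLattices Literature.Probability.Distributions BLPRS2013

/-! ### Statistics of the rounded Gaussian `floorGaussian L α₀` (law of `⌊L·e⌋`, `e ∼ N(0, α₀²/(2π))`) -/

/-- `floorGaussian L α₀` depends only on `(Lα₀)²`. [folklore] -/
theorem floorGaussian_congr {L L' : ℕ} {a a' : ℝ} (h : ((L : ℝ) * a) ^ 2 = ((L' : ℝ) * a') ^ 2) :
    floorGaussian L a = floorGaussian L' a' := by
  ext j
  rw [floorGaussian_apply, floorGaussian_apply, h]

/-- At width zero the rounded Gaussian is the point mass at `0`. [folklore] -/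
theorem floorGaussian_of_mul_eq_zero {L : ℕ} {a : ℝ} (h : (L : ℝ) * a = 0) : floorGaussian L a = PMF.pure 0 := by
  ext j
  rw [floorGaussian_apply, h, PMF.pure_apply]
  simp only [ne_eq, OfNat.ofNat_ne_zero, not_false_eq_true, zero_pow, zero_div, Real.toNNReal_zero,
    gaussianReal_zero_var]
  rw [Measure.dirac_apply' _ measurableSet_Ico, Set.indicator_apply]
  by_cases hj : j = 0
  · subst hj; simp
  · rw [if_neg hj, if_neg]
    rintro ⟨h1, h2⟩
    have h3 : (j : ℝ) ≤ 0 := h1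
    have h4 : (0 : ℝ) < j + 1 := h2
    have h5 : j ≤ 0 := by exact_mod_cast h3
    have h6 : (-1 : ℝ) < j := by linarith
    have h7 : -1 < j := by exact_mod_cast h6
    exact hj (by omega)

/-- **Grid refinement**: `⌊⌊M′M·e⌋ / M′⌋ = ⌊M·e⌋`, so dividing a sample of `floorGaussian (M′M) α₀` by
`M′` gives a sample of `floorGaussian M α₀`. [folklore] -/
theorem floorGaussian_map_ediv (M' M : ℕ) (hM' : 0 < M') (a : ℝ) :
    (floorGaussian (M' * M) a).map (fun z : ℤ => z / (M' : ℤ)) = floorGaussian M a := by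
  have hG : Measurable fun z : ℤ => z / (M' : ℤ) := measurable_of_countable _
  have hF : Measurable fun e : ℝ => ⌊((M' * M : ℕ) : ℝ) * e⌋ := measurable_floor_mul _
  have hcomp : (fun e : ℝ => ⌊(M : ℝ) * e⌋) = (fun z : ℤ => z / (M' : ℤ)) ∘ fun e : ℝ => ⌊((M' * M : ℕ) : ℝ) * e⌋ := by
    funext e
    simp only [Function.comp_apply]
    rw [Nat.cast_mul, mul_assoc, ← Int.floor_div_natCast _ M']
    congr 1
    have hM'r : (M' : ℝ) ≠ 0 := by exact_mod_cast hM'.ne'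
    field_simp
  unfold floorGaussian
  simp only [hcomp]
  exact (toPMF_map_comp _ hF hG).symm

/-- **Width domination of the cells**: for `0 < a ≤ b`, `(Ma)·Pr[⌊Mσ_a G⌋ = j] ≤ (Mb)·Pr[⌊Mσ_b G⌋ = j]`
cell by cell (`ρ_{Ma} ≤ ρ_{Mb}` pointwise). [folklore] -/
theorem mul_floorGaussian_le {M : ℕ} (hM : 0 < M) {a b : ℝ} (ha : 0 < a) (hab : a ≤ b) (j : ℤ) :
    ((M : ℝ) * a) * (floorGaussian M a j).toReal ≤ ((M : ℝ) * b) * (floorGaussian M b j).toReal := by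
  have hM' : (0 : ℝ) < M := by exact_mod_cast hM
  have hSa : 0 < (M : ℝ) * a := mul_pos hM' ha
  have hSb : 0 < (M : ℝ) * b := mul_pos hM' (ha.trans_le hab)
  rw [toReal_floorGaussian_apply M hSa, toReal_floorGaussian_apply M hSb]
  simp_rw [gaussianPDFReal_eq hSa, gaussianPDFReal_eq hSb]
  rw [integral_div, integral_div, mul_div_cancel₀ _ hSa.ne', mul_div_cancel₀ _ hSb.ne']
  have hia : IntegrableOn (fun x => gaussianFunction ((M : ℝ) * a) x) (Ico (j : ℝ) ((j : ℝ) + 1)) := by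
    have h := (integrable_gaussianPDFReal 0 (Real.toNNReal (((M : ℝ) * a) ^ 2 / (2 * π)))).integrableOn
      (s := Ico (j : ℝ) ((j : ℝ) + 1))
    have hpdf : gaussianPDFReal 0 (Real.toNNReal (((M : ℝ) * a) ^ 2 / (2 * π))) =
        fun x => gaussianFunction ((M : ℝ) * a) x / ((M : ℝ) * a) := funext fun x => gaussianPDFReal_eq hSa x
    rw [hpdf] at h
    have h2 : IntegrableOn (fun x => gaussianFunction ((M : ℝ) * a) x / ((M : ℝ) * a) * ((M : ℝ) * a))
        (Ico (j : ℝ) ((j : ℝ) + 1)) := h.mul_const ((M : ℝ) * a)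
    exact h2.congr_fun (fun x _ => by dsimp only; rw [div_mul_cancel₀ _ hSa.ne']) measurableSet_Ico
  have hib : IntegrableOn (fun x => gaussianFunction ((M : ℝ) * b) x) (Ico (j : ℝ) ((j : ℝ) + 1)) := by
    have h := (integrable_gaussianPDFReal 0 (Real.toNNReal (((M : ℝ) * b) ^ 2 / (2 * π)))).integrableOn
      (s := Ico (j : ℝ) ((j : ℝ) + 1))
    have hpdf : gaussianPDFReal 0 (Real.toNNReal (((M : ℝ) * b) ^ 2 / (2 * π))) =
        fun x => gaussianFunction ((M : ℝ) * b) x / ((M : ℝ) * b) := funext fun x => gaussianPDFReal_eq hSb x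
    rw [hpdf] at h
    have h2 : IntegrableOn (fun x => gaussianFunction ((M : ℝ) * b) x / ((M : ℝ) * b) * ((M : ℝ) * b))
        (Ico (j : ℝ) ((j : ℝ) + 1)) := h.mul_const ((M : ℝ) * b)
    exact h2.congr_fun (fun x _ => by dsimp only; rw [div_mul_cancel₀ _ hSb.ne']) measurableSet_Ico
  refine setIntegral_mono_on hia hib measurableSet_Ico fun x _ => ?_
  unfold gaussianFunction
  refine Real.exp_le_exp.2 ?_
  have hx : 0 ≤ π * ‖x‖ ^ 2 := by positivity
  have hsq : ((M : ℝ) * a) ^ 2 ≤ ((M : ℝ) * b) ^ 2 := pow_le_pow_left₀ hSa.le (mul_le_mul_of_nonneg_left hab hM'.le) 2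
  have hdiv : π * ‖x‖ ^ 2 / ((M : ℝ) * b) ^ 2 ≤ π * ‖x‖ ^ 2 / ((M : ℝ) * a) ^ 2 :=
    div_le_div_of_nonneg_left hx (pow_pos hSa 2) hsq
  have e1 : -π * ‖x‖ ^ 2 / ((M : ℝ) * a) ^ 2 = -(π * ‖x‖ ^ 2 / ((M : ℝ) * a) ^ 2) := by ring
  have e2 : -π * ‖x‖ ^ 2 / ((M : ℝ) * b) ^ 2 = -(π * ‖x‖ ^ 2 / ((M : ℝ) * b) ^ 2) := by ring
  rw [e1, e2]
  linarith

/-- **Width perturbation**: for `0 < a ≤ b`, `Δ(floorGaussian M b, floorGaussian M a) ≤ 1 - a/b` (one-sided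
domination `(a/b)·Pr_a ≤ Pr_b` cell by cell and `PMF.tvDist_le_of_forall_mem_le`). [folklore] -/
theorem tvDist_floorGaussian_width_le (M : ℕ) {a b : ℝ} (ha : 0 < a) (hab : a ≤ b) :
    (floorGaussian M b).tvDist (floorGaussian M a) ≤ 1 - a / b := by
  have hb : 0 < b := ha.trans_le hab
  have hc : 0 ≤ 1 - a / b := by rw [sub_nonneg, div_le_one hb]; exact hab
  rcases Nat.eq_zero_or_pos M with rfl | hM
  · rw [floorGaussian_of_mul_eq_zero (L := 0) (by simp), floorGaussian_of_mul_eq_zero (L := 0) (by simp),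
      PMF.tvDist_self]
    exact hc
  have h := PMF.tvDist_le_of_forall_mem_le (floorGaussian M b) (floorGaussian M a) Set.univ hc fun j _ => by
    have hdom := mul_floorGaussian_le hM ha hab j
    have hM' : (0 : ℝ) < M := by exact_mod_cast hM
    rw [show (1 - (1 - a / b)) = a / b by ring]
    rw [div_mul_eq_mul_div, div_le_iff₀ hb]
    have h0 : 0 ≤ (floorGaussian M a j).toReal := ENNReal.toReal_nonneg
    nlinarith [hdom]
  simpa using h

/-! ### The parameters of the sampler -/

/-- The internal precision `n = 2ℓ + 20` at accuracy request `ℓ`. [folklore] -/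
def gsPrec (ℓ : ℕ) : ℕ := ℓ + ℓ + 20

/-- The fine grid `M′ = 4ⁿ · den(s)` (so that `(M′M)²s ≥ 16ⁿ` whenever `M ≥ 1`, `s > 0`). [folklore] -/
def gsFine (s : ℚ) (n : ℕ) : ℕ := 4 ^ n * s.den

/-- The squared fine width `R₂ = (M′M)² s` (rational; its square root `M′M√s` is the width of the fine
rounded Gaussian `⌊M′M√s·G⌋`). [folklore] -/
def gsWidthSq (M : ℕ) (s : ℚ) (n : ℕ) : ℚ := ((gsFine s n * M : ℕ) : ℚ) * ((gsFine s n * M : ℕ) : ℚ) * s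

/-- The integer `N = round(4ⁿ R₂)`. [folklore] -/
def gsN (M : ℕ) (s : ℚ) (n : ℕ) : ℕ := (round (gsWidthSq M s n * ((4 ^ n : ℕ) : ℚ))).toNat

/-- **The rational upper approximation of the fine width** `ρ = (⌊√N⌋ + 1)/2ⁿ ∈ [√R₂, √R₂ + 2/2ⁿ]`.
[cite: Cohen1993, §1.7 (integer square roots)] -/
def gsRho (M : ℕ) (s : ℚ) (n : ℕ) : ℚ := (((Nat.sqrt (gsN M s n) + 1 : ℕ) : ℤ) : ℚ) / ((2 ^ n : ℕ) : ℚ)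

/-- The number of coins the sampler reads: `R·(w + 1 + P)` for the record `bootCtx ρ n` (`R = rejR n`
rounds of `w + 1 + n` coins, `w = bootW ρ n`). [cite: BrakerskiEtAl2013, §5] -/
def gsCoins (ρ : ℚ) (n : ℕ) : ℕ := rejR n * (bootW ρ n + 1 + n)

/-- `n = 2ℓ + 20`. [folklore] -/
theorem gsPrec_eq (ℓ : ℕ) : gsPrec ℓ = 2 * ℓ + 20 := by unfold gsPrec; ring

/-- `20 ≤ n`. [folklore] -/
theorem twenty_le_gsPrec (ℓ : ℕ) : 20 ≤ gsPrec ℓ := by unfold gsPrec; omega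

/-- `M′ > 0`. [folklore] -/
theorem gsFine_pos (s : ℚ) (n : ℕ) : 0 < gsFine s n := Nat.mul_pos (pow_pos (by norm_num) n) s.den_pos

/-- `R₂ ≥ 16ⁿ` for `M ≥ 1`, `s > 0`. [folklore] -/
theorem pow_le_gsWidthSq {M : ℕ} (hM : 0 < M) {s : ℚ} (hs : 0 < s) (n : ℕ) :
    ((16 : ℚ) ^ n) ≤ gsWidthSq M s n := by
  unfold gsWidthSq gsFine
  have hnum : 0 < s.num := Rat.num_pos.2 hs
  have hsd : s * s.den = s.num := Rat.mul_den_eq_num s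
  have hM1 : (1 : ℚ) ≤ M := by exact_mod_cast hM
  have hd1 : (1 : ℚ) ≤ s.den := by exact_mod_cast s.den_pos
  have hn1 : (1 : ℚ) ≤ s.num := by exact_mod_cast hnum
  push_cast
  have h16 : (16 : ℚ) ^ n = (4 : ℚ) ^ n * (4 : ℚ) ^ n := by rw [← mul_pow]; norm_num
  rw [h16]
  have h4 : (0 : ℚ) < (4 : ℚ) ^ n := by positivity
  -- `(4ⁿ d M)² s = 16ⁿ · d · M² · (s d) = 16ⁿ d M² num ≥ 16ⁿ`
  have hkey : (4 : ℚ) ^ n * s.den * M * ((4 : ℚ) ^ n * s.den * M) * s =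
      (4 : ℚ) ^ n * (4 : ℚ) ^ n * (s.den * (M * M) * (s * s.den)) := by ring
  rw [hkey, hsd]
  have h1 : (1 : ℚ) ≤ s.den * (M * M) * s.num := by
    have := mul_le_mul hd1 (mul_le_mul hM1 hM1 (by norm_num) (by linarith)) (by norm_num) (by linarith)
    nlinarith
  nlinarith

/-- `R₂ ≥ 0` for `s ≥ 0`. [folklore] -/
theorem gsWidthSq_nonneg (M : ℕ) {s : ℚ} (hs : 0 ≤ s) (n : ℕ) : 0 ≤ gsWidthSq M s n := by
  unfold gsWidthSq; positivity

/-- `√R₂ = M′M·√s`. [folklore] -/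
theorem sqrt_gsWidthSq (M : ℕ) {s : ℚ} (hs : 0 ≤ s) (n : ℕ) :
    Real.sqrt (gsWidthSq M s n : ℝ) = ((gsFine s n * M : ℕ) : ℝ) * Real.sqrt (s : ℝ) := by
  unfold gsWidthSq
  push_cast
  rw [show ((gsFine s n : ℝ) * M) * ((gsFine s n : ℝ) * M) * (s : ℝ) = (((gsFine s n : ℝ) * M) ^ 2) * s by ring,
    Real.sqrt_mul' _ (by exact_mod_cast hs), Real.sqrt_sq (by positivity)]

/-- **The rational bracket of the fine width**: `√R₂ ≤ ρ ≤ √R₂ + 2/2ⁿ`. [cite: Cohen1993, §1.7] -/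
theorem sqrt_le_gsRho (M : ℕ) {s : ℚ} (hs : 0 ≤ s) (n : ℕ) :
    Real.sqrt (gsWidthSq M s n : ℝ) ≤ (gsRho M s n : ℝ) ∧
      (gsRho M s n : ℝ) ≤ Real.sqrt (gsWidthSq M s n : ℝ) + 2 / (2 : ℝ) ^ n := by
  set R : ℚ := gsWidthSq M s n with hR
  have hR0 : (0 : ℝ) ≤ (R : ℝ) := by exact_mod_cast gsWidthSq_nonneg M hs n
  set x : ℚ := R * ((4 ^ n : ℕ) : ℚ) with hx
  have hx0 : 0 ≤ x := mul_nonneg (gsWidthSq_nonneg M hs n) (by positivity)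
  -- `N = round x`, `|N - x| ≤ 1/2`
  have hround : ((gsN M s n : ℤ) : ℚ) = round x := by
    unfold gsN
    rw [← hR, ← hx]
    have h0 : 0 ≤ round x := by
      have := abs_sub_round x
      have h1 : (round x : ℚ) ≥ x - 1 / 2 := by linarith [abs_le.1 this]
      have h2 : (-1 : ℚ) < round x := by linarith
      exact_mod_cast (show (-1 : ℤ) < round x by exact_mod_cast h2)
    rw [Int.toNat_of_nonneg h0]
  have hNx : |x - ((gsN M s n : ℕ) : ℚ)| ≤ 1 / 2 := by
    rw [show ((gsN M s n : ℕ) : ℚ) = ((gsN M s n : ℤ) : ℚ) by push_cast; rfl, hround]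
    exact abs_sub_round x
  set N : ℕ := gsN M s n with hN
  set q : ℕ := Nat.sqrt N with hq
  have hq1 : (q : ℝ) ^ 2 ≤ N := by exact_mod_cast Nat.sqrt_le' N
  have hq2 : (N : ℝ) + 1 ≤ ((q : ℝ) + 1) ^ 2 := by
    have := Nat.lt_succ_sqrt' N
    exact_mod_cast this
  have hxR : (x : ℝ) = (R : ℝ) * (4 : ℝ) ^ n := by rw [hx]; push_cast; ring
  have h4 : (4 : ℝ) ^ n = ((2 : ℝ) ^ n) ^ 2 := by rw [← pow_mul, mul_comm, pow_mul]; norm_num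
  have ht : (0 : ℝ) < (2 : ℝ) ^ n := by positivity
  have hloQ : x - 1 / 2 ≤ (N : ℚ) := by linarith [(abs_le.1 hNx).2]
  have hhiQ : (N : ℚ) ≤ x + 1 / 2 := by linarith [(abs_le.1 hNx).1]
  have hlo : (x : ℝ) - 1 / 2 ≤ (N : ℝ) := by
    have h := (Rat.cast_le (K := ℝ)).2 hloQ; push_cast at h; linarith
  have hhi : (N : ℝ) ≤ (x : ℝ) + 1 / 2 := by
    have h := (Rat.cast_le (K := ℝ)).2 hhiQ; push_cast at h; linarith
  have hρ : (gsRho M s n : ℝ) = ((q : ℝ) + 1) / (2 : ℝ) ^ n := by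
    unfold gsRho; rw [← hN, ← hq]; push_cast; ring
  rw [hρ]
  have hsx : Real.sqrt (R : ℝ) * (2 : ℝ) ^ n = Real.sqrt (x : ℝ) := by
    rw [hxR, h4, Real.sqrt_mul' _ (by positivity), Real.sqrt_sq ht.le]
  constructor
  · -- `√R · 2ⁿ = √x ≤ √(N + 1) ≤ q + 1`
    rw [le_div_iff₀ ht, hsx]
    calc Real.sqrt (x : ℝ) ≤ Real.sqrt ((N : ℝ) + 1) := Real.sqrt_le_sqrt (by linarith)
      _ ≤ (q : ℝ) + 1 := by
        rw [Real.sqrt_le_left (by positivity)]; exact hq2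
  · -- `q ≤ √N ≤ √(x + 1/2) ≤ √x + 1`
    rw [div_le_iff₀ ht, add_mul, div_mul_cancel₀ _ ht.ne', hsx]
    have hqN : (q : ℝ) ≤ Real.sqrt (N : ℝ) := Real.le_sqrt_of_sq_le hq1
    have hN2 : Real.sqrt (N : ℝ) ≤ Real.sqrt ((x : ℝ) + 1 / 2) := Real.sqrt_le_sqrt (by linarith)
    have hx0' : (0 : ℝ) ≤ (x : ℝ) := by exact_mod_cast hx0
    have h3 : Real.sqrt ((x : ℝ) + 1 / 2) ≤ Real.sqrt (x : ℝ) + 1 := by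
      rw [show Real.sqrt (x : ℝ) + 1 = Real.sqrt ((Real.sqrt (x : ℝ) + 1) ^ 2) by
        rw [Real.sqrt_sq (by positivity)]]
      apply Real.sqrt_le_sqrt
      nlinarith [Real.sq_sqrt hx0', Real.sqrt_nonneg (x : ℝ)]
    linarith

/-! ### The sampler program on codes -/

section Codes

open _root_.Computability Literature.Computability.Complexity Literature.Computability.Complexity.CodeFP
  Literature.Computability.Complexity.MachinPi GaussRejMachine DualGrid

variable {X : Type} {eX : X → List Bool} {ρf : X → ℚ} {nf : X → ℕ}

/-- The width parameter `bootA ρ n` from codes of `ρ` (binary rational) and `n` (unary): exact rational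
arithmetic, Machin `π`, `Nat.sqrt` (the computation of `Regev2009.bootA_codeFP`, over an arbitrary input
code). [cite: BorweinBorwein1987, §11.1; Cohen1993, §1.7] -/
theorem bootA_codeFP_of (hρ : CodeFP eX encodeRat ρf) (hn : CodeFP eX unE nf) :
    CodeFP eX natE (fun x => bootA (ρf x) (nf x)) := by
  have hnN : CodeFP eX natE (fun x => nf x) := (natOfUn.comp hn :)
  have hnQ : CodeFP eX encodeRat (fun x => (nf x : ℚ)) :=
    (ratOfIntNat.comp ((intOfNat.comp hnN).pair (const _ 1))).congr fun x => by simp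
  have hpi : CodeFP eX encodeRat (fun x => piApprox (nf x)) := (codeFP_piApprox.comp hn :)
  have hpow : CodeFP eX natE (fun x => 2 * 2 ^ nf x) :=
    (natMul.comp ((const _ 2).pair (natPow.comp ((const _ 2).pair hn))) :)
  have hcorr : CodeFP eX encodeRat (fun x => (1 : ℚ) / (2 * 2 ^ nf x)) :=
    (ratOfIntNat.comp ((const _ (1 : ℤ)).pair hpow)).congr fun x => by push_cast; rfl
  have hpl : CodeFP eX encodeRat (fun x => piLower (nf x)) :=
    (ratAdd.comp (hpi.pair (ratMul.comp ((const _ (-1 : ℚ)).pair hcorr)))).congr fun x => by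
      show piApprox (nf x) + (-1) * (1 / (2 * 2 ^ nf x)) = piLower (nf x)
      rw [piLower]; ring
  have hws : CodeFP eX encodeRat (fun x => widthSq (ρf x) (nf x)) :=
    (ratDiv.comp ((ratMul.comp ((ratMul.comp (hρ.pair hρ)).pair hnQ)).pair hpl)).congr fun x => by
      show ρf x * ρf x * (nf x : ℚ) / piLower (nf x) = widthSq (ρf x) (nf x)
      rw [widthSq, sq]
  exact (natAdd.comp ((natSqrt.comp (intToNat.comp (ratRound.comp hws))).pair (const _ 2)) :)

/-- The window exponent `bootW ρ n`, in unary, from the codes. [folklore] -/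
theorem bootW_codeFP_of (hρ : CodeFP eX encodeRat ρf) (hn : CodeFP eX unE nf) :
    CodeFP eX unE (fun x => bootW (ρf x) (nf x)) :=
  (unSucc.comp (natSizeU'_codeFP.comp (bootA_codeFP_of hρ hn)) :)

/-- The round count `rejR n`, in unary, from the codes. [folklore] -/
theorem rejR_codeFP_of (hn : CodeFP eX unE nf) : CodeFP eX unE (fun x => rejR (nf x)) := by
  have hsq : CodeFP eX unE (fun x => Nat.sqrt (nf x)) :=
    unOfNatLe hn (natSqrt.comp (natOfUn.comp hn) :) fun x => Nat.sqrt_le_self _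
  exact (unMulU_codeFP.comp ((unMulU_codeFP.comp ((const _ 96).pair (unSucc.comp hsq))).pair hn) :)

/-- A natural number computed in binary, recast as the rational `n/1`. [folklore] -/
theorem natCastRat_codeFP_of {f : X → ℕ} (hf : CodeFP eX natE f) : CodeFP eX encodeRat (fun x => (f x : ℚ)) :=
  (ratOfIntNat.comp ((intOfNat.comp hf).pair (const _ 1))).congr fun x => by simp

/-- **The sampler record `bootCtx ρ n` is computed in polynomial time from the codes** (`θ = n/A²`
exactly; unary fields under linear rulers, `2^{bootS n} ≤ 64n + 32`). [cite: BrakerskiEtAl2013, §5] -/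
theorem bootCtx_codeFP_of (hρ : CodeFP eX encodeRat ρf) (hn : CodeFP eX unE nf) :
    CodeFP eX rejCtxE (fun x => bootCtx (ρf x) (nf x)) := by
  have hnN : CodeFP eX natE (fun x => nf x) := (natOfUn.comp hn :)
  have hnQ : CodeFP eX encodeRat (fun x => (nf x : ℚ)) :=
    (ratOfIntNat.comp ((intOfNat.comp hnN).pair (const _ 1))).congr fun x => by simp
  have hAQ : CodeFP eX encodeRat (fun x => (bootA (ρf x) (nf x) : ℚ)) :=
    (ratOfIntNat.comp ((intOfNat.comp (bootA_codeFP_of hρ hn)).pair (const _ 1))).congr fun x => by simp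
  have hθ : CodeFP eX encodeRat (fun x => thetaA (bootA (ρf x) (nf x)) (nf x)) :=
    (ratDiv.comp (hnQ.pair (ratMul.comp (hAQ.pair hAQ)))).congr fun x => by rw [thetaA, sq]
  have hs : CodeFP eX unE (fun x => bootS (nf x)) :=
    (unAdd.comp ((natSizeU'_codeFP.comp hnN).pair (const _ 5)) :)
  have hN : CodeFP eX unE (fun x => bootS (nf x) + nf x + 2) :=
    (unAdd.comp ((unAdd.comp (hs.pair hn)).pair (const _ 2)) :)
  have hpadN : CodeFP eX natE (fun x => 2 ^ bootS (nf x)) := (natPow.comp ((const _ 2).pair hs) :)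
  have hr : CodeFP eX unE (fun x => 64 * nf x + 32) :=
    ((unPolyU_codeFP (Polynomial.C 64 * Polynomial.X + Polynomial.C 32)).comp hn).congr fun x => by simp
  have hpad : CodeFP eX unE (fun x => 2 ^ bootS (nf x)) := unOfNatLe hr hpadN fun x => two_pow_bootS_le _
  exact ((hθ.pair ((const _ (0 : ℚ)).pair (hs.pair (hN.pair (hn.pair hpad))))).pair
    ((bootW_codeFP_of hρ hn).pair (rejR_codeFP_of hn)) :)

/-- The sampler's input: parameters `(M, s, ℓ)` and a coin string. [folklore] -/
abbrev GSIn : Type := (ℕ × ℚ × ℕ) × List Bool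

/-- Its code `⟨⟨M, ⟨s, 1^ℓ⟩⟩, coins⟩` (`= boolPair (sampParams M s ℓ) coins`). [folklore] -/
abbrev gsInE : GSIn → List Bool := pairE (pairE natE (pairE encodeRat unE)) strE

/-- **The output of the sampler** on `(M, s, ℓ)` and coins `c`: `0` in the degenerate cases `M = 0` or
`s ≤ 0` (the target is then the point mass at `0`); otherwise ONE run of the rejection sampler
`rejOf (bootCtx ρ n)` for `D_{ℤ, A√(π/n)}` (`n = 2ℓ + 20`, `A = bootA ρ n`, `ρ` the rational bracket of
the fine width `4ⁿ·den(s)·M·√s`), divided by the fine-grid factor `M′ = 4ⁿ·den(s)`.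
[cite: Regev2009, Lemma 3.11 (proof, p. 18); GentryPeikertVaikuntanathan2008, §4.1] -/
def gsOut (x : GSIn) : ℤ :=
  if decide (x.1.1 = 0) || !decide (0 < x.1.2.1.num) then 0
  else rejOf (bootCtx (gsRho x.1.1 x.1.2.1 (gsPrec x.1.2.2)) (gsPrec x.1.2.2)) x.2 /
    (gsFine x.1.2.1 (gsPrec x.1.2.2) : ℤ)

/-- The precision `n = 2ℓ + 20`, in unary, from the input code. [folklore] -/
theorem gsPrec_codeFP : CodeFP gsInE unE (fun x : GSIn => gsPrec x.1.2.2) := by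
  have hl : CodeFP gsInE unE (fun x : GSIn => x.1.2.2) := (fst _ _).snd'.snd'
  exact (unAdd.comp ((unAdd.comp (hl.pair hl)).pair (const _ 20)) :)

/-- The fine-grid factor `M′ = 4ⁿ·den(s)`, in binary, from the input code. [folklore] -/
theorem gsFine_codeFP : CodeFP gsInE natE (fun x : GSIn => gsFine x.1.2.1 (gsPrec x.1.2.2)) := by
  have hs : CodeFP gsInE encodeRat (fun x : GSIn => x.1.2.1) := (fst _ _).snd'.fst'
  have hden : CodeFP gsInE natE (fun x : GSIn => x.1.2.1.den) := (ratNumDen.comp hs).snd'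
  have h4n : CodeFP gsInE natE (fun x : GSIn => 4 ^ gsPrec x.1.2.2) :=
    (natPow.comp ((const _ 4).pair gsPrec_codeFP) :)
  exact (natMul.comp (h4n.pair hden) :)

/-- The rational width bracket `ρ = gsRho M s n` is computed in polynomial time (exact rational
arithmetic, `round`, `Nat.sqrt`). [cite: Cohen1993, §1.7] -/
theorem gsRho_codeFP : CodeFP gsInE encodeRat (fun x : GSIn => gsRho x.1.1 x.1.2.1 (gsPrec x.1.2.2)) := by
  have hM : CodeFP gsInE natE (fun x : GSIn => x.1.1) := (fst _ _).fst'
  have hs : CodeFP gsInE encodeRat (fun x : GSIn => x.1.2.1) := (fst _ _).snd'.fst'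
  have hn := gsPrec_codeFP
  have hFM : CodeFP gsInE natE (fun x : GSIn => gsFine x.1.2.1 (gsPrec x.1.2.2) * x.1.1) :=
    (natMul.comp (gsFine_codeFP.pair hM) :)
  have hFMQ : CodeFP gsInE encodeRat (fun x : GSIn => ((gsFine x.1.2.1 (gsPrec x.1.2.2) * x.1.1 : ℕ) : ℚ)) :=
    natCastRat_codeFP_of hFM
  have hR : CodeFP gsInE encodeRat (fun x : GSIn => gsWidthSq x.1.1 x.1.2.1 (gsPrec x.1.2.2)) :=
    (ratMul.comp ((ratMul.comp (hFMQ.pair hFMQ)).pair hs) :)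
  have h4n : CodeFP gsInE natE (fun x : GSIn => 4 ^ gsPrec x.1.2.2) := (natPow.comp ((const _ 4).pair hn) :)
  have h4nQ : CodeFP gsInE encodeRat (fun x : GSIn => ((4 ^ gsPrec x.1.2.2 : ℕ) : ℚ)) :=
    natCastRat_codeFP_of h4n
  have hN : CodeFP gsInE natE (fun x : GSIn => gsN x.1.1 x.1.2.1 (gsPrec x.1.2.2)) :=
    (intToNat.comp (ratRound.comp (ratMul.comp (hR.pair h4nQ))) :)
  have hq1 : CodeFP gsInE natE (fun x : GSIn => Nat.sqrt (gsN x.1.1 x.1.2.1 (gsPrec x.1.2.2)) + 1) :=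
    (natAdd.comp ((natSqrt.comp hN).pair (const _ 1)) :)
  have h2n : CodeFP gsInE natE (fun x : GSIn => 2 ^ gsPrec x.1.2.2) := (natPow.comp ((const _ 2).pair hn) :)
  exact (ratOfIntNat.comp ((intOfNat.comp hq1).pair h2n) :)

/-- **The sampler is a polynomial-time function of its input code** (output in sign-magnitude binary).
[cite: Regev2009, Lemma 3.11 (proof, p. 18); GentryPeikertVaikuntanathan2008, §4.1] -/
theorem gsOut_codeFP : CodeFP gsInE smE gsOut := by
  have hM : CodeFP gsInE natE (fun x : GSIn => x.1.1) := (fst _ _).fst'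
  have hs : CodeFP gsInE encodeRat (fun x : GSIn => x.1.2.1) := (fst _ _).snd'.fst'
  have hc : CodeFP gsInE strE (fun x : GSIn => x.2) := snd _ _
  have hctx : CodeFP gsInE rejCtxE
      (fun x : GSIn => bootCtx (gsRho x.1.1 x.1.2.1 (gsPrec x.1.2.2)) (gsPrec x.1.2.2)) :=
    bootCtx_codeFP_of gsRho_codeFP gsPrec_codeFP
  have hrej : CodeFP gsInE intE
      (fun x : GSIn => rejOf (bootCtx (gsRho x.1.1 x.1.2.1 (gsPrec x.1.2.2)) (gsPrec x.1.2.2)) x.2) :=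
    (rejOf_codeFP.comp (hctx.pair hc) :)
  have hdiv : CodeFP gsInE intE
      (fun x : GSIn => rejOf (bootCtx (gsRho x.1.1 x.1.2.1 (gsPrec x.1.2.2)) (gsPrec x.1.2.2)) x.2 /
        (gsFine x.1.2.1 (gsPrec x.1.2.2) : ℤ)) :=
    (intEDiv.comp (hrej.pair (intOfNat.comp gsFine_codeFP)) :)
  have hnum : CodeFP gsInE intE (fun x : GSIn => x.1.2.1.num) := (ratNumDen.comp hs).fst'
  have hcond : CodeFP gsInE bitE (fun x : GSIn => decide (x.1.1 = 0) || !decide (0 < x.1.2.1.num)) :=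
    ((natEq.comp (hM.pair (const _ 0))).or (intLt.comp ((const _ (0 : ℤ)).pair hnum)).not :)
  have hout : CodeFP gsInE intE gsOut := (hcond.ite (const _ (0 : ℤ)) hdiv :)
  exact (smOfInt.comp hout :)

end Codes

/-! ### The coin count is polynomial in the parameter code -/

/-- The unary code of `k` has length `k`. [folklore] -/
theorem length_unaryEncodeNat (k : ℕ) : (Computability.unaryEncodeNat k).length = k := by
  induction k with
  | zero => rfl
  | succ k ih => simp [Computability.unaryEncodeNat, ih]

/-- The length of the parameter code `⟨M, ⟨s, 1^ℓ⟩⟩`. [folklore] -/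
theorem length_sampParams (M : ℕ) (s : ℚ) (ℓ : ℕ) : (sampParams M s ℓ).length =
    2 * Nat.size M + 4 * Nat.size s.num.natAbs + 2 * Nat.size s.den + ℓ + 24 := by
  rw [sampParams, Literature.Computability.Complexity.length_boolPair, Literature.Computability.Complexity.length_boolPair,
    Literature.Computability.Complexity.CodeFP.length_encodeRat,
    Literature.Computability.Complexity.TM2Pass.length_encodeNat_eq_size, length_unaryEncodeNat]
  ring

/-- `|num ρ| ≤ ⌊√N⌋ + 1` for `ρ = (⌊√N⌋ + 1)/2ⁿ`. [folklore] -/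
theorem natAbs_num_gsRho_le (M : ℕ) (s : ℚ) (n : ℕ) :
    (gsRho M s n).num.natAbs ≤ Nat.sqrt (gsN M s n) + 1 := by
  unfold gsRho
  set a : ℕ := Nat.sqrt (gsN M s n) + 1
  have h2 : ((2 ^ n : ℕ) : ℤ) ≠ 0 := by positivity
  have hdiv : ((a : ℤ) : ℚ) / ((2 ^ n : ℕ) : ℚ) = Rat.divInt (a : ℤ) ((2 ^ n : ℕ) : ℤ) := by
    rw [Rat.divInt_eq_div]; push_cast; rfl
  rw [hdiv]
  have hd := Rat.num_dvd (a : ℤ) h2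
  have := Int.natAbs_dvd_natAbs.2 hd
  simpa using Nat.le_of_dvd (by positivity) this

/-- `N ≤ 64ⁿ · den(s)² · M² · |num s|` (for `s > 0`). [folklore] -/
theorem gsN_le {M : ℕ} {s : ℚ} (hs : 0 < s) (n : ℕ) :
    gsN M s n ≤ 64 ^ n * s.den ^ 2 * M ^ 2 * s.num.natAbs := by
  unfold gsN
  set x : ℚ := gsWidthSq M s n * ((4 ^ n : ℕ) : ℚ) with hx_def
  set B : ℕ := 64 ^ n * s.den ^ 2 * M ^ 2 * s.num.natAbs with hB
  have hnum : 0 < s.num := Rat.num_pos.2 hs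
  have hsν : s ≤ (s.num.natAbs : ℚ) := by
    have h1 : (s.num.natAbs : ℚ) = s.num := by
      rw [Nat.cast_natAbs, Int.cast_abs, abs_of_pos (by exact_mod_cast hnum)]
    rw [h1, ← Rat.mul_den_eq_num s]
    have hd1 : (1 : ℚ) ≤ s.den := by exact_mod_cast s.den_pos
    nlinarith
  have hx : x ≤ (B : ℚ) := by
    rw [hx_def, hB]; unfold gsWidthSq gsFine; push_cast
    have h64 : (64 : ℚ) ^ n = (4 : ℚ) ^ n * (4 : ℚ) ^ n * (4 : ℚ) ^ n := by rw [← mul_pow, ← mul_pow]; norm_num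
    rw [h64]
    have h0 : (0 : ℚ) ≤ (4 : ℚ) ^ n * s.den * M * ((4 : ℚ) ^ n * s.den * M) * (4 : ℚ) ^ n := by positivity
    calc (4 : ℚ) ^ n * s.den * M * ((4 : ℚ) ^ n * s.den * M) * s * (4 : ℚ) ^ n
        = ((4 : ℚ) ^ n * s.den * M * ((4 : ℚ) ^ n * s.den * M) * (4 : ℚ) ^ n) * s := by ring
      _ ≤ ((4 : ℚ) ^ n * s.den * M * ((4 : ℚ) ^ n * s.den * M) * (4 : ℚ) ^ n) * (s.num.natAbs : ℚ) :=
          mul_le_mul_of_nonneg_left hsν h0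
      _ = (4 : ℚ) ^ n * (4 : ℚ) ^ n * (4 : ℚ) ^ n * (s.den : ℚ) ^ 2 * (M : ℚ) ^ 2 * s.num.natAbs := by ring
  have hr : round x ≤ (B : ℤ) := by
    have h := abs_sub_round x
    have h1 : ((round x : ℤ) : ℚ) ≤ (B : ℚ) + 1 / 2 := by linarith [(abs_le.1 h).1]
    have h3 : round x < (B : ℤ) + 1 := by
      have h2 : ((round x : ℤ) : ℚ) < (((B : ℤ) + 1 : ℤ) : ℚ) := by push_cast; linarith
      exact_mod_cast h2
    omega
  exact (Int.toNat_le_toNat hr).trans (by simp)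

/-- **The coin count is cubic in the parameter length**: `gsCoins ρ n ≤ 6912·|⟨M, s, 1^ℓ⟩|³` (`M ≥ 1`, `s > 0`).
[folklore] -/
theorem gsCoins_le {M : ℕ} (hM : 0 < M) {s : ℚ} (hs : 0 < s) (ℓ : ℕ) :
    gsCoins (gsRho M s (gsPrec ℓ)) (gsPrec ℓ) ≤ 6912 * (sampParams M s ℓ).length ^ 3 := by
  set n := gsPrec ℓ with hn
  set L := (sampParams M s ℓ).length with hL_def
  have hL : L = 2 * Nat.size M + 4 * Nat.size s.num.natAbs + 2 * Nat.size s.den + ℓ + 24 := length_sampParams M s ℓ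
  have hn20 : n = 2 * ℓ + 20 := gsPrec_eq ℓ
  set ρ := gsRho M s n with hρ
  -- the window
  have hW : bootW ρ n ≤ Nat.size ρ.num.natAbs + n + 3 := by rw [bootW_eq]; exact wA_bootA_le ρ n
  have hnum : ρ.num.natAbs ≤ Nat.sqrt (gsN M s n) + 1 := natAbs_num_gsRho_le M s n
  set B : ℕ := 64 ^ n * s.den ^ 2 * M ^ 2 * s.num.natAbs with hB
  have hNB : gsN M s n ≤ B := gsN_le hs n
  have hq : Nat.sqrt (gsN M s n) + 1 ≤ B + 1 := Nat.succ_le_succ ((Nat.sqrt_le_self _).trans hNB)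
  -- `B + 1 < 2^(K+1)`, `K = 6n + 2·size den + 2·size M + size |num s|`
  set K : ℕ := 6 * n + 2 * Nat.size s.den + 2 * Nat.size M + Nat.size s.num.natAbs with hK
  have hd : s.den < 2 ^ Nat.size s.den := Nat.lt_size_self _
  have hMs : M < 2 ^ Nat.size M := Nat.lt_size_self _
  have hν : s.num.natAbs < 2 ^ Nat.size s.num.natAbs := Nat.lt_size_self _
  have hBK : B < 2 ^ K := by
    have h64 : (64 : ℕ) ^ n = 2 ^ (6 * n) := by rw [pow_mul]; norm_num
    have h1 : s.den ^ 2 < (2 ^ Nat.size s.den) ^ 2 := Nat.pow_lt_pow_left hd (by norm_num)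
    have h2 : M ^ 2 < (2 ^ Nat.size M) ^ 2 := Nat.pow_lt_pow_left hMs (by norm_num)
    have hpos : 0 < 64 ^ n := by positivity
    calc B = 64 ^ n * s.den ^ 2 * M ^ 2 * s.num.natAbs := hB
      _ < 64 ^ n * (2 ^ Nat.size s.den) ^ 2 * (2 ^ Nat.size M) ^ 2 * 2 ^ Nat.size s.num.natAbs := by
          have hM2 : 0 < M ^ 2 := by positivity
          have hd2 : 0 < s.den ^ 2 := by positivity
          calc 64 ^ n * s.den ^ 2 * M ^ 2 * s.num.natAbs
              < 64 ^ n * s.den ^ 2 * M ^ 2 * 2 ^ Nat.size s.num.natAbs :=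
                Nat.mul_lt_mul_of_pos_left hν (by positivity)
            _ ≤ 64 ^ n * (2 ^ Nat.size s.den) ^ 2 * (2 ^ Nat.size M) ^ 2 * 2 ^ Nat.size s.num.natAbs := by
                gcongr
      _ = 2 ^ K := by
          rw [hK, h64, ← pow_mul, ← pow_mul, ← pow_add, ← pow_add, ← pow_add]; ring_nf
  have hsz : Nat.size ρ.num.natAbs ≤ K + 1 := by
    refine Nat.size_le.2 ?_
    calc ρ.num.natAbs ≤ B + 1 := hnum.trans hq
      _ < 2 ^ K + 2 ^ K := by omega
      _ = 2 ^ (K + 1) := by rw [pow_succ]; ring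
  -- the round count
  have hsq : Nat.sqrt n + 1 ≤ n := Nat.succ_le_of_lt (Nat.sqrt_lt_self (by omega))
  have hR : rejR n ≤ 96 * n * n := by
    unfold rejR; exact Nat.mul_le_mul_right _ (Nat.mul_le_mul_left _ hsq)
  -- assemble
  have hW' : bootW ρ n + 1 + n ≤ 18 * L := by omega
  have hn2 : n ≤ 2 * L := by omega
  unfold gsCoins
  calc rejR n * (bootW ρ n + 1 + n) ≤ (96 * n * n) * (18 * L) := Nat.mul_le_mul hR hW'
    _ ≤ (96 * (2 * L) * (2 * L)) * (18 * L) := by gcongr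
    _ = 6912 * L ^ 3 := by ring

/-! ### The output law: within `114·n/2ⁿ` of the rounded Gaussian -/

section Law

open _root_.Computability Literature.Computability.Complexity Literature.Computability.Complexity.CodeFP GaussRejMachine

/-- **The core estimate.** For `M, M′ ≥ 1`, `16 ≤ n`, a width `σ₊ > 0` with fine width
`S′ = M′Mσ₊ ≥ 4ⁿ` and a rational `ρ ∈ [S′, S′ + 2/2ⁿ]`: one run of the rejection sampler for
`D_{ℤ, A√(π/n)}` (`A = bootA ρ n`) divided by `M′` is within `114n/2ⁿ` of `floorGaussian M σ₊` —
sampler accuracy `113(⌊√n⌋+1)/2ⁿ` (Brakerski et al. 2013, §5), discrete-vs-rounded `2/S̃ ≤ 1/2ⁿ`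
(Peikert 2010, §3.3), grid division exact, width perturbation `1 − S′/S̃ ≤ 5/2ⁿ`.
[cite: BrakerskiEtAl2013, §5 (Lemma 5.3); Peikert2010, §3.3; Regev2009, Lemma 3.11 (proof, p. 18)] -/
theorem tvDist_map_rejLaw_floorGaussian_le {M F n : ℕ} (hM : 0 < M) (hF : 0 < F) (h16 : 16 ≤ n)
    {ρ : ℚ} {σp : ℝ} (hσp : 0 < σp) (hSp4 : (4 : ℝ) ^ n ≤ ((F * M : ℕ) : ℝ) * σp)
    (hρlo : ((F * M : ℕ) : ℝ) * σp ≤ (ρ : ℝ)) (hρhi : (ρ : ℝ) ≤ ((F * M : ℕ) : ℝ) * σp + 2 / (2 : ℝ) ^ n) :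
    ((GaussRej.rejLaw (thetaA (bootA ρ n) n) 0 (bootS n) (bootS n + n + 2) n (bootW ρ n) (rejR n)).map
        fun z : ℤ => z / (F : ℤ)).tvDist (floorGaussian M σp) ≤ 114 * (n : ℝ) / (2 : ℝ) ^ n := by
  have hn0 : 0 < n := by omega
  have ht : (0 : ℝ) < (2 : ℝ) ^ n := by positivity
  have ht1 : (2 : ℝ) ≤ (2 : ℝ) ^ n := by
    calc (2 : ℝ) = 2 ^ 1 := by norm_num
      _ ≤ 2 ^ n := pow_le_pow_right₀ (by norm_num) (by omega)
  have h4t : (4 : ℝ) ^ n = (2 : ℝ) ^ n * (2 : ℝ) ^ n := by rw [← mul_pow]; norm_num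
  set Sp : ℝ := ((F * M : ℕ) : ℝ) * σp with hSp
  have hSp2t : 2 * (2 : ℝ) ^ n ≤ Sp := by nlinarith
  have hSp0 : 0 < Sp := by nlinarith
  have hSp2 : 2 ≤ Sp := by nlinarith
  -- `ρ ≥ 2^{2n}`
  have hρ2n : (2 : ℝ) ^ (2 * n) ≤ (ρ : ℝ) := by
    rw [pow_mul, show (2 : ℝ) ^ 2 = 4 by norm_num]; exact hSp4.trans hρlo
  have hρpos : (0 : ℝ) < ρ := hSp0.trans_le hρlo
  have hρ0 : (0 : ℚ) ≤ ρ := by exact_mod_cast hρpos.le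
  have hρ2 : (2 : ℚ) ≤ ρ := by
    have h : (2 : ℝ) ≤ ρ := by linarith
    exact_mod_cast h
  -- the width of the sampler (tree facts)
  have hA0 : 0 < bootA ρ n := bootA_pos ρ n
  have hnA : n ≤ bootA ρ n ^ 2 := le_bootA_sq hρ2 n
  set St : ℝ := (bootA ρ n : ℝ) * Real.sqrt (π / n) with hSt
  have hρSt : (ρ : ℝ) ≤ St := rho_le_bootWidth hρ0 hn0
  have hStρ : St ≤ (ρ : ℝ) * (1 + 2 / (2 : ℝ) ^ n) := bootWidth_le h16 hρ2n
  have hSpSt : Sp ≤ St := hρlo.trans hρSt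
  have hSt0 : 0 < St := hSp0.trans_le hSpSt
  -- `S̃ ≤ S′ (1 + 5/2ⁿ)`
  set u : ℝ := 2 / (2 : ℝ) ^ n with hu
  have hu0 : 0 < u := by positivity
  have hu1 : u ≤ 1 := by rw [hu, div_le_one ht]; exact ht1
  have hStSp : St ≤ Sp + 5 / 2 * Sp * u := by
    have h1 : St ≤ (Sp + u) * (1 + u) :=
      hStρ.trans (mul_le_mul_of_nonneg_right hρhi (by positivity))
    have h2 : u * u ≤ u * 1 := mul_le_mul_of_nonneg_left hu1 hu0.le
    have h3 : 2 * u ≤ Sp * u := mul_le_mul_of_nonneg_right hSp2 hu0.le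
    have h4 : 0 ≤ Sp * u := by positivity
    nlinarith
  -- `1 - S′/S̃ ≤ 5/2ⁿ`
  have hgap : 1 - Sp / St ≤ 5 / (2 : ℝ) ^ n := by
    have h1 : St - Sp ≤ 5 / (2 : ℝ) ^ n * St := by
      have h5 : 5 / 2 * Sp * u = 5 / (2 : ℝ) ^ n * Sp := by rw [hu]; ring
      have h6 : 5 / (2 : ℝ) ^ n * Sp ≤ 5 / (2 : ℝ) ^ n * St := mul_le_mul_of_nonneg_left hSpSt (by positivity)
      linarith
    have h2 : Sp / St = 1 - (St - Sp) / St := by field_simp; ring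
    rw [h2, sub_sub_cancel, div_le_iff₀ hSt0]
    exact h1
  -- `2/S̃ ≤ 1/2ⁿ`
  have h2St : 2 / St ≤ 1 / (2 : ℝ) ^ n := by
    calc 2 / St ≤ 2 / (2 * (2 : ℝ) ^ n) :=
          div_le_div_of_nonneg_left (by norm_num) (by positivity) (hSp2t.trans hSpSt)
      _ = 1 / (2 : ℝ) ^ n := by rw [← div_div, div_self (by norm_num : (2 : ℝ) ≠ 0)]
  -- the sampler's accuracy at the machine's parameters
  have hrej : (GaussRej.rejLaw (thetaA (bootA ρ n) n) 0 (bootS n) (bootS n + n + 2) n (bootW ρ n)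
      (rejR n)).tvDist (discreteGaussianInt St 0) ≤ 113 * ((Nat.sqrt n : ℝ) + 1) / 2 ^ n := by
    have h := tvDist_rejLaw_wide_le hA0 hnA h16 (0 : ℚ)
    rw [sqrt_pi_div_thetaA hA0 hn0, Rat.cast_zero, show rejN n = bootS n + n + 2 by
      rw [rejN, bootS_eq hn0.ne'], ← bootS_eq hn0.ne', ← bootW_eq, show rejP n = n from rfl] at h
    exact h
  -- the fine rounded Gaussian and the grid
  have hFM0 : (0 : ℝ) < ((F * M : ℕ) : ℝ) := by exact_mod_cast Nat.mul_pos hF hM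
  set σ' : ℝ := St / ((F * M : ℕ) : ℝ) with hσ'
  have hFMσ' : ((F * M : ℕ) : ℝ) * σ' = St := by rw [hσ']; field_simp
  have hdG : (discreteGaussianInt St 0).tvDist (floorGaussian (F * M) σ') ≤ 2 / St := by
    have h := tvDist_discreteGaussianInt_floorGaussian_le (F * M) (α₀ := σ') (by rw [hFMσ']; exact hSt0)
    rw [hFMσ'] at h
    exact h
  have hgrid : (floorGaussian (F * M) σ').map (fun z : ℤ => z / (F : ℤ)) = floorGaussian M σ' :=
    floorGaussian_map_ediv F M hF σ'
  have hσpσ' : σp ≤ σ' := by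
    rw [hσ', le_div_iff₀ hFM0, mul_comm]
    exact hSpSt
  have hwidth : (floorGaussian M σ').tvDist (floorGaussian M σp) ≤ 1 - σp / σ' :=
    tvDist_floorGaussian_width_le M hσp hσpσ'
  have hratio : σp / σ' = Sp / St := by
    rw [hσ', hSp]; field_simp
  -- assemble
  set rej := GaussRej.rejLaw (thetaA (bootA ρ n) n) 0 (bootS n) (bootS n + n + 2) n (bootW ρ n) (rejR n)
    with hrej_def
  have hsq : (Nat.sqrt n : ℝ) + 1 ≤ n := by
    exact_mod_cast (Nat.succ_le_of_lt (Nat.sqrt_lt_self (by omega)) : Nat.sqrt n + 1 ≤ n)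
  have hn6 : (6 : ℝ) ≤ n := by exact_mod_cast (by omega : 6 ≤ n)
  calc (rej.map fun z : ℤ => z / (F : ℤ)).tvDist (floorGaussian M σp)
      ≤ (rej.map fun z : ℤ => z / (F : ℤ)).tvDist ((floorGaussian (F * M) σ').map fun z : ℤ => z / (F : ℤ)) +
          ((floorGaussian (F * M) σ').map fun z : ℤ => z / (F : ℤ)).tvDist (floorGaussian M σp) :=
        PMF.tvDist_triangle_holds _ _ _
    _ ≤ rej.tvDist (floorGaussian (F * M) σ') + (floorGaussian M σ').tvDist (floorGaussian M σp) := by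
        have h1 := PMF.tvDist_map_le_holds (fun z : ℤ => z / (F : ℤ)) rej (floorGaussian (F * M) σ')
        have h2 : ((floorGaussian (F * M) σ').map fun z : ℤ => z / (F : ℤ)).tvDist (floorGaussian M σp) =
            (floorGaussian M σ').tvDist (floorGaussian M σp) := by rw [hgrid]
        linarith
    _ ≤ (rej.tvDist (discreteGaussianInt St 0) + (discreteGaussianInt St 0).tvDist (floorGaussian (F * M) σ')) +
          (1 - Sp / St) := by
        rw [← hratio]; exact add_le_add (PMF.tvDist_triangle_holds _ _ _) hwidth
    _ ≤ 113 * ((Nat.sqrt n : ℝ) + 1) / 2 ^ n + 1 / (2 : ℝ) ^ n + 5 / (2 : ℝ) ^ n := by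
        linarith [hrej, hdG.trans h2St, hgap]
    _ = (113 * ((Nat.sqrt n : ℝ) + 1) + 6) / (2 : ℝ) ^ n := by ring
    _ ≤ 114 * (n : ℝ) / (2 : ℝ) ^ n := div_le_div_of_nonneg_right (by nlinarith) ht.le

/-- **The degenerate case**: for `M = 0` or `s ≤ 0` the program outputs `0`. [folklore] -/
theorem gsOut_eq_zero {M : ℕ} {s : ℚ} (h : M = 0 ∨ ¬ 0 < s) (ℓ : ℕ) (c : List Bool) :
    gsOut ((M, s, ℓ), c) = 0 := by
  rw [gsOut, if_pos]
  rcases h with h | h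
  · simp [h]
  · have hn : ¬ 0 < s.num := fun h' => h (Rat.num_pos.1 h')
    simp [hn]

/-- **The main case**: for `M ≥ 1`, `s > 0` the program outputs the sampler value divided by `M′`. [folklore] -/
theorem gsOut_eq {M : ℕ} (hM : 0 < M) {s : ℚ} (hs : 0 < s) (ℓ : ℕ) (c : List Bool) :
    gsOut ((M, s, ℓ), c) = rejFlat (thetaA (bootA (gsRho M s (gsPrec ℓ)) (gsPrec ℓ)) (gsPrec ℓ)) 0
      (bootS (gsPrec ℓ)) (bootS (gsPrec ℓ) + gsPrec ℓ + 2) (gsPrec ℓ) (bootW (gsRho M s (gsPrec ℓ)) (gsPrec ℓ))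
        (rejR (gsPrec ℓ)) c / (gsFine s (gsPrec ℓ) : ℤ) := by
  have hnum : 0 < s.num := Rat.num_pos.2 hs
  rw [gsOut, if_neg (by simp [hM.ne', hnum]), bootCtx, rejOf_rejCtxOf]

/-- **The output law of the program is the image law of the sampler.** [folklore] -/
theorem uniform_map_gsOut_eq {M : ℕ} (hM : 0 < M) {s : ℚ} (hs : 0 < s) (ℓ : ℕ) {C : ℕ}
    (hC : gsCoins (gsRho M s (gsPrec ℓ)) (gsPrec ℓ) ≤ C) :
    ((PMF.uniformOfFintype (QReg C)).map fun c => gsOut ((M, s, ℓ), List.ofFn c)) =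
      (GaussRej.rejLaw (thetaA (bootA (gsRho M s (gsPrec ℓ)) (gsPrec ℓ)) (gsPrec ℓ)) 0 (bootS (gsPrec ℓ))
        (bootS (gsPrec ℓ) + gsPrec ℓ + 2) (gsPrec ℓ) (bootW (gsRho M s (gsPrec ℓ)) (gsPrec ℓ)) (rejR (gsPrec ℓ))).map
        fun z : ℤ => z / (gsFine s (gsPrec ℓ) : ℤ) := by
  set n := gsPrec ℓ
  set ρ := gsRho M s n
  have hfun : (fun c : QReg C => gsOut ((M, s, ℓ), List.ofFn c)) = fun c : QReg C =>
      (fun z : ℤ => z / (gsFine s n : ℤ)) (rejFlat (thetaA (bootA ρ n) n) 0 (bootS n) (bootS n + n + 2) n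
        (bootW ρ n) (rejR n) (List.ofFn c)) := funext fun c => gsOut_eq hM hs ℓ _
  rw [hfun, ← PMF.uniformOfFintype_map_equiv (Equiv.vectorEquivFin Bool C), PMF.map_comp]
  have hcomp : ((fun c : QReg C => (fun z : ℤ => z / (gsFine s n : ℤ)) (rejFlat (thetaA (bootA ρ n) n) 0 (bootS n)
      (bootS n + n + 2) n (bootW ρ n) (rejR n) (List.ofFn c))) ∘ ⇑(Equiv.vectorEquivFin Bool C)) =
      (fun z : ℤ => z / (gsFine s n : ℤ)) ∘ fun v : List.Vector Bool C =>
        rejFlat (thetaA (bootA ρ n) n) 0 (bootS n) (bootS n + n + 2) n (bootW ρ n) (rejR n) v.toList := by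
    funext v
    show (fun z : ℤ => z / (gsFine s n : ℤ)) (rejFlat _ _ _ _ _ _ _ (List.ofFn v.get)) =
      (fun z : ℤ => z / (gsFine s n : ℤ)) (rejFlat _ _ _ _ _ _ _ v.toList)
    rw [ofFn_get_eq_toList]
  have hC' : rejR n * (bootW ρ n + 1 + n) ≤ C := hC
  rw [hcomp, ← PMF.map_comp, uniformVector_map_rejFlat _ _ _ _ _ _ (rejR n) hC']

/-- **Accuracy of the sampler program**: for `M ≥ 1`, `s > 0`, `σ² = s` and at least `gsCoins` uniform
coins, the output law is within `2^{-ℓ}` of `floorGaussian M σ`. [cite: Regev2009, Lemma 3.11 (proof, p. 18);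
BrakerskiEtAl2013, §5; Peikert2010, §3.3] -/
theorem tvDist_gsOut_le {M : ℕ} (hM : 0 < M) {s : ℚ} (hs : 0 < s) (ℓ : ℕ) {σ : ℝ} (hσ : σ ^ 2 = (s : ℝ))
    {C : ℕ} (hC : gsCoins (gsRho M s (gsPrec ℓ)) (gsPrec ℓ) ≤ C) :
    ((PMF.uniformOfFintype (QReg C)).map fun c => gsOut ((M, s, ℓ), List.ofFn c)).tvDist (floorGaussian M σ) ≤
      (2⁻¹ : ℝ) ^ ℓ := by
  rw [uniform_map_gsOut_eq hM hs ℓ hC]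
  set n := gsPrec ℓ with hn_def
  have hn20 : 20 ≤ n := twenty_le_gsPrec ℓ
  have hs0 : (0 : ℚ) ≤ s := hs.le
  have hsR : (0 : ℝ) ≤ (s : ℝ) := by exact_mod_cast hs0
  -- the true width `σ₊ = √s` and `floorGaussian M σ = floorGaussian M σ₊`
  set σp : ℝ := Real.sqrt (s : ℝ) with hσp
  have hσp0 : 0 < σp := Real.sqrt_pos.2 (by exact_mod_cast hs)
  have hfg : floorGaussian M σ = floorGaussian M σp :=
    floorGaussian_congr (by rw [mul_pow, mul_pow, hσ, hσp, Real.sq_sqrt hsR])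
  rw [hfg]
  -- the fine width `S′ = M′M√s = √R₂ ≥ 4ⁿ` and the bracket `ρ`
  have hSp_eq : Real.sqrt (gsWidthSq M s n : ℝ) = ((gsFine s n * M : ℕ) : ℝ) * σp := sqrt_gsWidthSq M hs0 n
  have hSp4 : (4 : ℝ) ^ n ≤ ((gsFine s n * M : ℕ) : ℝ) * σp := by
    rw [← hSp_eq]
    have h16r : (16 : ℝ) ^ n ≤ (gsWidthSq M s n : ℝ) := by exact_mod_cast pow_le_gsWidthSq hM hs n
    calc (4 : ℝ) ^ n = Real.sqrt (((4 : ℝ) ^ n) ^ 2) := (Real.sqrt_sq (by positivity)).symm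
      _ = Real.sqrt ((16 : ℝ) ^ n) := by rw [← pow_mul, mul_comm, pow_mul]; norm_num
      _ ≤ Real.sqrt (gsWidthSq M s n : ℝ) := Real.sqrt_le_sqrt h16r
  obtain ⟨hρlo, hρhi⟩ := sqrt_le_gsRho M hs0 n
  rw [hSp_eq] at hρlo hρhi
  refine (tvDist_map_rejLaw_floorGaussian_le hM (gsFine_pos s n) (by omega) hσp0 hSp4 hρlo hρhi).trans ?_
  -- `114 n / 2ⁿ ≤ 2^{-ℓ}` for `n = 2ℓ + 20`
  have hnat : 114 * n * 2 ^ ℓ ≤ 2 ^ n := by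
    have hℓ : ℓ < 2 ^ ℓ := Nat.lt_two_pow_self
    rw [gsPrec_eq] at hn_def
    rw [hn_def, show 2 * ℓ + 20 = ℓ + (ℓ + 20) by ring, pow_add, pow_add]
    have h20 : (2 : ℕ) ^ 20 = 1048576 := by norm_num
    rw [h20]
    nlinarith
  have ht : (0 : ℝ) < (2 : ℝ) ^ n := by positivity
  have hl : (0 : ℝ) < (2 : ℝ) ^ ℓ := by positivity
  have hcast : (114 : ℝ) * n * (2 : ℝ) ^ ℓ ≤ (2 : ℝ) ^ n := by exact_mod_cast hnat
  rw [inv_pow, div_le_iff₀ ht, ← one_div, one_div_mul_eq_div, le_div_iff₀ hl]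
  linarith

end Law

/-! ### The discharge of `floorGaussianSamplerFP` -/

section Discharge

open _root_.Computability Literature.Computability.Complexity Literature.Computability.Complexity.CodeFP

/-- The program's input code is the parameter code paired with the coins. [folklore] -/
theorem gsInE_eq (M : ℕ) (s : ℚ) (ℓ : ℕ) (c : List Bool) :
    gsInE ((M, s, ℓ), c) = boolPair (sampParams M s ℓ) c := rfl

/-- **The law of an FP function computing `gsOut` is the law of `gsOut`.** [folklore] -/
theorem sampLaw_eq_map_gsOut {G : List Bool → List Bool} (hG : ∀ x : GSIn, G (gsInE x) = smE (gsOut x))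
    (pc : Polynomial ℕ) (M : ℕ) (s : ℚ) (ℓ : ℕ) :
    sampLaw G pc M s ℓ = (PMF.uniformOfFintype (QReg (pc.eval (sampParams M s ℓ).length))).map
      fun c => gsOut ((M, s, ℓ), List.ofFn c) := by
  unfold sampLaw
  congr 1
  funext c
  have h := hG ((M, s, ℓ), List.ofFn c)
  rw [gsInE_eq] at h
  rw [h, smE]
  exact decodeIntD_encode _

/-- **Regev 2009, Lemma 3.11 — the coin sampler, PROVED.** The named fact `floorGaussianSamplerFP`
(`RegevReductionCVPqSamplerSplit`: a polynomial-time sampler for the rounded Gaussian `⌊M·N(0, s/2π)⌋`,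
within `2^{-ℓ}` in statistical distance, uniformly in `(M, s, ℓ)`) holds: the program `gsOut` —
one run of the exact-rational rejection sampler for `D_{ℤ, A√(π/n)}` at a fine grid, divided by the
grid factor — is in FP (`gsOut_codeFP`), reads at most `6912·|⟨M, s, 1^ℓ⟩|³` coins (`gsCoins_le`),
and is `2^{-ℓ}`-accurate (`tvDist_gsOut_le`). [cite: Regev2009, Lemma 3.11 (proof, p. 18);
GentryPeikertVaikuntanathan2008, §4.1; BrakerskiEtAl2013, §5; Peikert2010, §3.3] -/
theorem floorGaussianSamplerFP_holds : floorGaussianSamplerFP := by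
  obtain ⟨G, hG, hGs⟩ := gsOut_codeFP
  refine ⟨G, Polynomial.C 6912 * Polynomial.X ^ 3, hG, fun M s ℓ σ hσ => ?_⟩
  rw [sampLaw_eq_map_gsOut hGs]
  by_cases hdeg : M = 0 ∨ ¬ 0 < s
  · -- degenerate: the output is `0` and the target is the point mass at `0`
    have hfun : (fun c : QReg ((Polynomial.C 6912 * Polynomial.X ^ 3 : Polynomial ℕ).eval
        (sampParams M s ℓ).length) => gsOut ((M, s, ℓ), List.ofFn c)) = fun _ => 0 :=
      funext fun c => gsOut_eq_zero hdeg ℓ _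
    have htarget : floorGaussian M σ = PMF.pure 0 := by
      refine floorGaussian_of_mul_eq_zero ?_
      rcases hdeg with h | h
      · subst h; simp
      · have hs0 : (s : ℝ) ≤ 0 := by exact_mod_cast not_lt.1 h
        have hσ0 : σ = 0 := by nlinarith [sq_nonneg σ]
        rw [hσ0, mul_zero]
    have hconst : (PMF.uniformOfFintype (QReg ((Polynomial.C 6912 * Polynomial.X ^ 3 : Polynomial ℕ).eval
        (sampParams M s ℓ).length))).map (fun _ => (0 : ℤ)) = PMF.pure 0 := PMF.map_const _ _
    rw [hfun, hconst, htarget, PMF.tvDist_self]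
    positivity
  · push Not at hdeg
    obtain ⟨hM, hs⟩ := hdeg
    refine tvDist_gsOut_le (Nat.pos_of_ne_zero hM) hs ℓ hσ ?_
    simpa using gsCoins_le (Nat.pos_of_ne_zero hM) hs ℓ

end Discharge

end Regev2009

/-! ### Consequences: the quantum step and pqc.S19 from `{A_plumb, A_q14}` -/

section Consequences

open _root_.Computability Literature.Computability.Complexity

variable (q : ℕ → ℕ) [∀ n, NeZero (q n)] (α : ℕ → ℝ)

/-- **Regev 2009, Lemma 3.11 — the classical half of the quantum step is a theorem of the TM
plumbing alone**: `A_cvpqM` follows from `A_plumb` (the coin sampler `A_gsamp` is now proved,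
`Regev2009.floorGaussianSamplerFP_holds`). [cite: Regev2009, Lemma 3.11 (p. 18)] -/
theorem regev2009_lemma_3_11_cvpqMachine_of_plumbing (hT : regev2009_lemma_3_11_cvpqPlumbing q α) :
    regev2009_lemma_3_11_cvpqMachine q α :=
  regev2009_lemma_3_11_cvpqMachine_of_sampler_of_plumbing q α Regev2009.floorGaussianSamplerFP_holds hT

/-- **Regev 2009, Theorem 3.1 (SIVP form) from `{A_plumb, A_q14}`**: the worst-case-SIVP-to-LWE quantum
reduction `regev_lwe_to_sivp_quantum` follows from the TM plumbing of Lemma 3.11 and the quantum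
step family of Lemma 3.14. [cite: Regev2009, Theorem 3.1 (p. 13), Lemma 3.11 (p. 18), Lemma 3.14 (p. 20)] -/
theorem regev_lwe_to_sivp_quantum_holds_of_plumbing_of_step (m : ℕ → ℕ)
    (hT : regev2009_lemma_3_11_cvpqPlumbing q α) (hQ : regev2009_lemma_3_14_stepFamily q α) :
    regev_lwe_to_sivp_quantum q α m :=
  regev_lwe_to_sivp_quantum_holds_of_sampler_of_plumbing_of_step q α m
    Regev2009.floorGaussianSamplerFP_holds hT hQ

/-- **Regev 2009, Theorem 3.1 (GapSVP form) from `{A_plumb, A_q14}`**. [cite: Regev2009, Theorem 3.1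
(p. 13), Lemma 3.11 (p. 18), Lemma 3.14 (p. 20), Lemma 3.20 (p. 22)] -/
theorem regev_lwe_to_gapSVP_quantum_holds_of_plumbing_of_step (m : ℕ → ℕ)
    (hT : regev2009_lemma_3_11_cvpqPlumbing q α) (hQ : regev2009_lemma_3_14_stepFamily q α) :
    regev_lwe_to_gapSVP_quantum q α m :=
  regev_lwe_to_gapSVP_quantum_holds_of_sampler_of_plumbing_of_step q α m
    Regev2009.floorGaussianSamplerFP_holds hT hQ

end Consequences

end Literature.Computability.Cryptography
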